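import Mathlib.RingTheory.Polynomial.Cyclotomic.Roots
import Mathlib.RingTheory.AlgebraicIndependent.Transcendental
import Literature.NumberTheory.Transcendental.GammaIsoCrossTransfer
import Literature.NumberTheory.Transcendental.ZilberFieldSaturationMain
import HarnessLib

/-!
# The base Γ-fields `ℚ^{ab}(τ)` of two exponential fields with standard kernel are isomorphic

M. Bays, J. Kirby, *Pseudo-exponential maps, variants, and quasiminimality*, Algebra & Number
Theory 12 (2018), §9.1: for pseudo-exponentiation the base Γ-field is `F_base = ℚ^{ab}(τ)` with
`Γ(F_base)` the graph of `τ/m ↦ ω_m` ("this `F_base` is called SK in [FPEF]"), and proof of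
Thm 9.1: "Since `τ` is transcendental and the kernel is standard, it follows that `F_base` embeds
strongly in `F`" — in particular the base Γ-fields `ℚ(ℚτ, exp ℚτ) = ℚ^{ab}(τ)` of any two
exponential fields `F₁`, `F₂` with standard kernels `τ₁ℤ`, `τ₂ℤ` (`τᵢ` transcendental) are
isomorphic as Γ-fields, `τ₁ ↦ τ₂`, `exp (τ₁ q) ↦ exp (τ₂ q)`. This is the starting point of
every isomorphism between two Zilber fields (Zilber 2005, Thm 1.1; Bays–Kirby 2018, Thm 9.1), and
the base isomorphism `σ₀` over which the cross-field Γ-isomorphisms of `GammaIsoCross.lean` are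
taken. This file PROVES it:

* `GammaField.fieldOf_bot`, `GammaField.botBaseEquiv F₁ F₂ : (⊥ : Submodule ℚ F₁)⁰ ≃+* (⊥)⁰`
  (both are `ℚ`), `GammaField.isEBaseIso₂_bot`, and the bridge
  `GammaField.isGammaIsoTw₂_bot_iff`: a cross Γ-isomorphism over the trivial bases is the
  equality of the relation ideals OVER `ℚ` of the level generators;
* `GammaField.aeval_lvGens_single_iff_of_expKernel` — **`(τ₁, exp (τ₁/M!))` and
  `(τ₂, exp (τ₂/M!))` satisfy the same polynomial relations over `ℚ`**: `exp (τᵢ/M!)` are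
  primitive `M!`-th roots of unity (`ZilberSaturationMain.isPrimitiveRoot_exp_div`), so generate
  isomorphic fields (same minimal polynomial, the cyclotomic polynomial), over which `τᵢ` are
  transcendental;
* `GammaField.isGammaIsoTw₂_bot_single_of_expKernel` — hence `(τ₁) ↦ (τ₂)` is a cross
  Γ-isomorphism over the trivial bases;
* `GammaField.stdKernelBaseEquiv` — **the isomorphism `σ₀ : ℚ^{ab}(τ₁) ≃+* ℚ^{ab}(τ₂)` of base
  Γ-fields** (`fieldOf (ℚτ₁) ≃+* fieldOf (ℚτ₂)`), with `GammaField.isEBaseIso₂_stdKernelBaseEquiv`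
  (`σ₀(ℚτ₁) = ℚτ₂`, `σ₀ ∘ exp = exp ∘ σ₀` on `ℚτ₁`) and `GammaField.coe_stdKernelBaseEquiv_tau`
  (`σ₀ τ₁ = τ₂`).

Everything is proved.

## References

* M. Bays, J. Kirby, *Pseudo-exponential maps, variants, and quasiminimality*, Algebra & Number
  Theory 12 (2018) 493–549: §9.1, Thm 9.1 (proof).
* J. Kirby, *Finitely presented exponential fields*, Algebra & Number Theory 7 (2013): §2 ("SK").
* B. Zilber, *Pseudo-exponentiation on algebraically closed fields of characteristic zero*,
  Ann. Pure Appl. Logic 132 (2005): Thm 1.1.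
-/

noncomputable section

open Set

universe u

namespace Literature.NumberTheory.Transcendental

namespace GammaField

open Literature.ModelTheory.ExponentialFields.ExponentialRing ZilberHomogeneity

/-! ### The trivial base `⊥` and its Γ-field `ℚ` -/

section Bot

variable {F : Type u} [Field F] [CharZero F] [Literature.ModelTheory.ExponentialFields.ExponentialRing F]

/-- The Γ-field of the zero subspace is `ℚ`: `fieldOf ⊥ = ⊥`. [folklore] -/
theorem fieldOf_bot : fieldOf (⊥ : Submodule ℚ F) = ⊥ := by
  refine le_antisymm (IntermediateField.adjoin_le_iff.2 ?_) bot_le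
  intro x hx
  rcases mem_gens_iff.1 hx with hx | ⟨y, hy, rfl⟩
  · have hx0 : x = 0 := (Submodule.mem_bot ℚ).1 hx
    rw [hx0]
    exact zero_mem _
  · have hy0 : y = 0 := (Submodule.mem_bot ℚ).1 hy
    rw [hy0, Literature.ModelTheory.ExponentialFields.ExponentialRing.exp_zero]
    exact one_mem _

/-- Elements of `fieldOf ⊥` are rational numbers. [folklore] -/
theorem exists_algebraMap_eq_of_mem_fieldOf_bot {x : F} (hx : x ∈ fieldOf (⊥ : Submodule ℚ F)) :
    ∃ q : ℚ, algebraMap ℚ F q = x := by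
  rw [fieldOf_bot, IntermediateField.mem_bot] at hx
  exact hx

variable (F) in
/-- `fieldOf ⊥ ≃ₐ[ℚ] ℚ`. [folklore] -/
def botFieldEquiv : fieldOf (⊥ : Submodule ℚ F) ≃ₐ[ℚ] ℚ :=
  (IntermediateField.equivOfEq fieldOf_bot).trans (IntermediateField.botEquiv ℚ F)

/-- Every element of `fieldOf ⊥` is the image of a rational. [folklore] -/
theorem exists_eq_algebraMap_fieldOf_bot (k : fieldOf (⊥ : Submodule ℚ F)) :
    ∃ q : ℚ, k = algebraMap ℚ (fieldOf (⊥ : Submodule ℚ F)) q := by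
  obtain ⟨q, hq⟩ := exists_algebraMap_eq_of_mem_fieldOf_bot k.2
  exact ⟨q, Subtype.ext hq.symm⟩

/-- `algebraMap ℚ _ ∘ botFieldEquiv = id` on `fieldOf ⊥`. [folklore] -/
theorem algebraMap_botFieldEquiv (k : fieldOf (⊥ : Submodule ℚ F)) :
    algebraMap ℚ (fieldOf (⊥ : Submodule ℚ F)) (botFieldEquiv F k) = k := by
  obtain ⟨q, rfl⟩ := exists_eq_algebraMap_fieldOf_bot k
  rw [AlgEquiv.commutes]
  rfl

end Bot

/-! ### The canonical isomorphism of the trivial base Γ-fields of two fields -/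

section BotTwo

variable {F₁ : Type u} [Field F₁] [CharZero F₁] [Literature.ModelTheory.ExponentialFields.ExponentialRing F₁]
variable {F₂ : Type u} [Field F₂] [CharZero F₂] [Literature.ModelTheory.ExponentialFields.ExponentialRing F₂]

variable (F₁ F₂) in
/-- The canonical isomorphism `(⊥ : Submodule ℚ F₁)⁰ ≃+* (⊥ : Submodule ℚ F₂)⁰` (both are `ℚ`).
[folklore] -/
def botBaseEquiv : fieldOf (⊥ : Submodule ℚ F₁) ≃+* fieldOf (⊥ : Submodule ℚ F₂) :=
  ((botFieldEquiv F₁).trans (botFieldEquiv F₂).symm).toRingEquiv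

/-- `botBaseEquiv` is the identity on rationals. [folklore] -/
@[simp] theorem botBaseEquiv_algebraMap (q : ℚ) :
    botBaseEquiv F₁ F₂ (algebraMap ℚ _ q) = algebraMap ℚ _ q := by
  change ((botFieldEquiv F₁).trans (botFieldEquiv F₂).symm) (algebraMap ℚ _ q) = algebraMap ℚ _ q
  rw [AlgEquiv.commutes]

/-- `botBaseEquiv ∘ algebraMap ℚ = algebraMap ℚ`. [folklore] -/
theorem botBaseEquiv_comp_algebraMap :
    ((botBaseEquiv F₁ F₂ : fieldOf (⊥ : Submodule ℚ F₁) →+* fieldOf (⊥ : Submodule ℚ F₂)).comp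
        (algebraMap ℚ (fieldOf (⊥ : Submodule ℚ F₁)))) =
      algebraMap ℚ (fieldOf (⊥ : Submodule ℚ F₂)) := by
  refine RingHom.ext fun q => ?_
  exact botBaseEquiv_algebraMap q

/-- The inverse of `botBaseEquiv` is `botBaseEquiv`. [folklore] -/
theorem botBaseEquiv_symm : (botBaseEquiv F₁ F₂).symm = botBaseEquiv F₂ F₁ := rfl

/-- **`botBaseEquiv` is an isomorphism of (trivial) base Γ-fields.** [folklore] -/
theorem isEBaseIso₂_bot : IsEBaseIso₂ (⊥ : Submodule ℚ F₁) (⊥ : Submodule ℚ F₂) (botBaseEquiv F₁ F₂) := by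
  have key : ∀ {x : F₁} (hx : x ∈ (⊥ : Submodule ℚ F₁)) (hx' : x ∈ fieldOf (⊥ : Submodule ℚ F₁)),
      (botBaseEquiv F₁ F₂ ⟨x, hx'⟩ : F₂) = 0 := by
    intro x hx hx'
    have hx0 : x = 0 := (Submodule.mem_bot ℚ).1 hx
    subst hx0
    have : (⟨0, hx'⟩ : fieldOf (⊥ : Submodule ℚ F₁)) = 0 := Subtype.ext rfl
    rw [this, map_zero]
    rfl
  have key' : ∀ {y : F₂} (hy : y ∈ (⊥ : Submodule ℚ F₂)) (hy' : y ∈ fieldOf (⊥ : Submodule ℚ F₂)),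
      ((botBaseEquiv F₁ F₂).symm ⟨y, hy'⟩ : F₁) = 0 := by
    intro y hy hy'
    have hy0 : y = 0 := (Submodule.mem_bot ℚ).1 hy
    subst hy0
    have : (⟨0, hy'⟩ : fieldOf (⊥ : Submodule ℚ F₂)) = 0 := Subtype.ext rfl
    rw [this, map_zero]
    rfl
  refine ⟨fun hx => ?_, fun hy => ?_, fun {x} hx => ?_⟩
  · rw [key hx]; exact zero_mem _
  · rw [key' hy]; exact zero_mem _
  · have hx0 : x = 0 := (Submodule.mem_bot ℚ).1 hx
    subst hx0
    rw [key hx]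
    have h1 : (⟨exp (0 : F₁), exp_mem_fieldOf hx⟩ : fieldOf (⊥ : Submodule ℚ F₁)) = 1 :=
      Subtype.ext (by
        show exp (0 : F₁) = ((1 : fieldOf (⊥ : Submodule ℚ F₁)) : F₁)
        rw [Literature.ModelTheory.ExponentialFields.ExponentialRing.exp_zero]; rfl)
    rw [h1, map_one, Literature.ModelTheory.ExponentialFields.ExponentialRing.exp_zero]
    rfl

/-- Polynomials over `fieldOf ⊥` are polynomials over `ℚ`, compatibly with `botBaseEquiv`.
[folklore] -/
theorem exists_map_algebraMap_eq {ι : Type*} (P : MvPolynomial ι (fieldOf (⊥ : Submodule ℚ F₁))) :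
    ∃ P₀ : MvPolynomial ι ℚ,
      MvPolynomial.map (algebraMap ℚ (fieldOf (⊥ : Submodule ℚ F₁))) P₀ = P ∧
      MvPolynomial.map (botBaseEquiv F₁ F₂ : fieldOf (⊥ : Submodule ℚ F₁) →+* fieldOf (⊥ : Submodule ℚ F₂)) P =
        MvPolynomial.map (algebraMap ℚ (fieldOf (⊥ : Submodule ℚ F₂))) P₀ := by
  refine ⟨MvPolynomial.map (botFieldEquiv F₁ : fieldOf (⊥ : Submodule ℚ F₁) →+* ℚ) P, ?_, ?_⟩
  · rw [MvPolynomial.map_map]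
    have : (algebraMap ℚ (fieldOf (⊥ : Submodule ℚ F₁))).comp
        (botFieldEquiv F₁ : fieldOf (⊥ : Submodule ℚ F₁) →+* ℚ) = RingHom.id _ := by
      ext k
      exact congrArg Subtype.val (algebraMap_botFieldEquiv k)
    rw [this, MvPolynomial.map_id]
  · rw [MvPolynomial.map_map]
    congr 1

/-- **Cross Γ-isomorphisms over the trivial bases are equalities of relation ideals over `ℚ`**:
`IsGammaIsoTw₂ (botBaseEquiv F₁ F₂) c c'` iff for every level `M` a polynomial over `ℚ`
vanishes at `(c, exp (c/M!))` iff it vanishes at `(c', exp (c'/M!))`. [folklore] -/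
theorem isGammaIsoTw₂_bot_iff {N : ℕ} {c : Fin N → F₁} {c' : Fin N → F₂} :
    IsGammaIsoTw₂ (botBaseEquiv F₁ F₂) c c' ↔
      ∀ (M : ℕ) (P : MvPolynomial (Fin N ⊕ Fin N) ℚ),
        MvPolynomial.aeval (lvGens M c) P = 0 ↔ MvPolynomial.aeval (lvGens M c') P = 0 := by
  constructor
  · intro h M P₀
    have := h M (MvPolynomial.map (algebraMap ℚ (fieldOf (⊥ : Submodule ℚ F₁))) P₀)
    rwa [MvPolynomial.map_map, botBaseEquiv_comp_algebraMap, MvPolynomial.aeval_map_algebraMap,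
      MvPolynomial.aeval_map_algebraMap] at this
  · intro h M P
    obtain ⟨P₀, hP₀, hmap⟩ := exists_map_algebraMap_eq (F₂ := F₂) P
    rw [hmap, ← hP₀, MvPolynomial.aeval_map_algebraMap, MvPolynomial.aeval_map_algebraMap]
    exact h M P₀

end BotTwo

/-! ### `(τ₁, exp (τ₁/M!))` and `(τ₂, exp (τ₂/M!))` have the same relation ideal over `ℚ` -/

section TauKernel

variable {F₁ : Type u} [Field F₁] [CharZero F₁] [Literature.ModelTheory.ExponentialFields.ExponentialRing F₁]
variable {F₂ : Type u} [Field F₂] [CharZero F₂] [Literature.ModelTheory.ExponentialFields.ExponentialRing F₂]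

omit [Literature.ModelTheory.ExponentialFields.ExponentialRing F₁]
  [Literature.ModelTheory.ExponentialFields.ExponentialRing F₂] in
/-- **Two primitive `n`-th roots of unity (in two fields of characteristic zero) satisfy the same
polynomial relations over `ℚ`**: both have the cyclotomic polynomial as minimal polynomial, so
`ℚ(ζ₁) ≅ ℚ(ζ₂)` with `ζ₁ ↦ ζ₂`. [folklore] -/
theorem aeval_const_iff_of_isPrimitiveRoot {ζ₁ : F₁} {ζ₂ : F₂} {n : ℕ} (hn : 0 < n)
    (h₁ : IsPrimitiveRoot ζ₁ n) (h₂ : IsPrimitiveRoot ζ₂ n) {ι : Type*} (Q : MvPolynomial ι ℚ) :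
    MvPolynomial.aeval (fun _ : ι => ζ₁) Q = 0 ↔ MvPolynomial.aeval (fun _ : ι => ζ₂) Q = 0 := by
  have hi₁ : IsIntegral ℚ ζ₁ := (h₁.isIntegral hn).tower_top
  have hi₂ : IsIntegral ℚ ζ₂ := (h₂.isIntegral hn).tower_top
  have hmin : minpoly ℚ ζ₁ = minpoly ℚ ζ₂ := by
    rw [← Polynomial.cyclotomic_eq_minpoly_rat h₁ hn, ← Polynomial.cyclotomic_eq_minpoly_rat h₂ hn]
  -- `ℚ(ζ₁) ≅ ℚ(ζ₂)`, `ζ₁ ↦ ζ₂`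
  let φ := ((IntermediateField.adjoinRootEquivAdjoin ℚ hi₁).symm.trans
      (AdjoinRoot.algEquivOfEq ℚ _ _ hmin)).trans (IntermediateField.adjoinRootEquivAdjoin ℚ hi₂)
  have hφ : φ (IntermediateField.AdjoinSimple.gen ℚ ζ₁) = IntermediateField.AdjoinSimple.gen ℚ ζ₂ := by
    show IntermediateField.adjoinRootEquivAdjoin ℚ hi₂ (AdjoinRoot.algEquivOfEq ℚ _ _ hmin
      ((IntermediateField.adjoinRootEquivAdjoin ℚ hi₁).symm (IntermediateField.AdjoinSimple.gen ℚ ζ₁))) = _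
    rw [IntermediateField.adjoinRootEquivAdjoin_symm_apply_gen, AdjoinRoot.algEquivOfEq_root,
      IntermediateField.adjoinRootEquivAdjoin_apply_root]
  -- the two embeddings of `ℚ(ζ₁)`
  let ψ₁ : IntermediateField.adjoin ℚ {ζ₁} →+* F₁ := algebraMap _ F₁
  let ψ₂ : IntermediateField.adjoin ℚ {ζ₁} →+* F₂ :=
    (algebraMap (IntermediateField.adjoin ℚ {ζ₂}) F₂).comp φ.toRingEquiv.toRingHom
  have hψ₁ : ψ₁ (IntermediateField.AdjoinSimple.gen ℚ ζ₁) = ζ₁ := rfl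
  have hψ₂ : ψ₂ (IntermediateField.AdjoinSimple.gen ℚ ζ₁) = ζ₂ := by
    show ((φ (IntermediateField.AdjoinSimple.gen ℚ ζ₁) : IntermediateField.adjoin ℚ {ζ₂}) : F₂) = ζ₂
    rw [hφ]; rfl
  let g : ι → IntermediateField.adjoin ℚ {ζ₁} := fun _ => IntermediateField.AdjoinSimple.gen ℚ ζ₁
  have key : ∀ {K : Type u} [Field K] [CharZero K] (ψ : IntermediateField.adjoin ℚ {ζ₁} →+* K)
      (P : MvPolynomial ι ℚ),
      MvPolynomial.aeval (fun _ : ι => ψ (IntermediateField.AdjoinSimple.gen ℚ ζ₁)) P =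
        ψ (MvPolynomial.aeval g P) := by
    intro K _ _ ψ P
    have hext : (MvPolynomial.aeval (fun _ : ι => ψ (IntermediateField.AdjoinSimple.gen ℚ ζ₁))).toRingHom =
        ψ.comp (MvPolynomial.aeval (R := ℚ) g).toRingHom := by
      refine MvPolynomial.ringHom_ext (fun q => ?_) (fun i => ?_)
      · simp only [AlgHom.toRingHom_eq_coe, RingHom.coe_coe, MvPolynomial.aeval_C, RingHom.coe_comp,
          Function.comp_apply]
        rw [eq_ratCast, eq_ratCast, map_ratCast]
      · simp only [AlgHom.toRingHom_eq_coe, RingHom.coe_coe, MvPolynomial.aeval_X, RingHom.coe_comp,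
          Function.comp_apply]
        rfl
    exact congrArg (fun f : MvPolynomial ι ℚ →+* K => f P) hext
  have k₁ := key ψ₁ Q
  have k₂ := key ψ₂ Q
  rw [hψ₁] at k₁
  rw [hψ₂] at k₂
  rw [k₁, k₂, map_eq_zero_iff ψ₁ ψ₁.injective, map_eq_zero_iff ψ₂ ψ₂.injective]

/-- `exp (τ/M!)` is a primitive `M!`-th root of unity when `ker exp = τℤ`, `τ ≠ 0`. [folklore] -/
theorem isPrimitiveRoot_exp_div_factorial {τ : F₁} (hker : expKernel F₁ = AddSubgroup.zmultiples τ)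
    (hτ : τ ≠ 0) (M : ℕ) : IsPrimitiveRoot (exp (τ / (M.factorial : F₁))) M.factorial :=
  ZilberSaturationMain.isPrimitiveRoot_exp_div hker hτ M.factorial_pos

omit [CharZero F₁] in
/-- The level-`M` generators of the `1`-tuple `(τ)`. [folklore] -/
theorem lvGens_single (M : ℕ) (τ : F₁) :
    lvGens M ![τ] = Sum.elim ![τ] (fun _ : Fin 1 => exp (τ / (M.factorial : F₁))) := by
  funext j
  rcases j with i | i
  · rfl
  · simp [lvGens]

omit [Literature.ModelTheory.ExponentialFields.ExponentialRing F₁] in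
/-- A transcendental element stays transcendental over `ℚ[ζ]` for `ζ` algebraic: the `1`-tuple
`(τ)` is algebraically independent over `ℚ[ζ]`. [folklore] -/
theorem algebraicIndependent_single_adjoin_of_isAlgebraic {τ ζ : F₁} (hτ : Transcendental ℚ τ)
    (hζ : IsAlgebraic ℚ ζ) {ι : Type*} :
    AlgebraicIndependent (Algebra.adjoin ℚ (range fun _ : ι => ζ)) ![τ] := by
  set S := Algebra.adjoin ℚ (range fun _ : ι => ζ) with hS
  haveI : Algebra.IsAlgebraic ℚ S := by
    rw [← Subalgebra.isAlgebraic_iff, hS, Algebra.isAlgebraic_adjoin_iff]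
    rintro _ ⟨i, rfl⟩
    exact hζ
  exact algebraicIndependent_iff_transcendental.2 (hτ.extendScalars S)

/-- **`(τ₁, exp (τ₁/M!))` and `(τ₂, exp (τ₂/M!))` satisfy the same polynomial relations over
`ℚ`** when `ker exp = τᵢℤ` with `τᵢ` transcendental (`i = 1, 2`, two exponential fields): the
exponentials are primitive `M!`-th roots of unity, which have the same relations over `ℚ`
(cyclotomic minimal polynomial), and `τᵢ` is transcendental over `ℚ[exp (τᵢ/M!)]`, so both
relation ideals are generated by that of the root of unity (Bays–Kirby 2018, proof of Thm 9.1: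
"Since `τ` is transcendental and the kernel is standard, … `F_base` embeds strongly in `F`").
[cite: BaysKirby2018ANT, Thm 9.1 (proof)] -/
theorem aeval_lvGens_single_iff_of_expKernel {τ₁ : F₁} {τ₂ : F₂}
    (hker₁ : expKernel F₁ = AddSubgroup.zmultiples τ₁) (hτ₁ : Transcendental ℚ τ₁)
    (hker₂ : expKernel F₂ = AddSubgroup.zmultiples τ₂) (hτ₂ : Transcendental ℚ τ₂)
    (M : ℕ) (P : MvPolynomial (Fin 1 ⊕ Fin 1) ℚ) :
    MvPolynomial.aeval (lvGens M ![τ₁]) P = 0 ↔ MvPolynomial.aeval (lvGens M ![τ₂]) P = 0 := by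
  have hτ₁0 : τ₁ ≠ 0 := fun h => hτ₁ (h ▸ isAlgebraic_zero)
  have hτ₂0 : τ₂ ≠ 0 := fun h => hτ₂ (h ▸ isAlgebraic_zero)
  have hζ₁ := isPrimitiveRoot_exp_div_factorial hker₁ hτ₁0 M
  have hζ₂ := isPrimitiveRoot_exp_div_factorial hker₂ hτ₂0 M
  have hp₁ := algebraicIndependent_single_adjoin_of_isAlgebraic (ι := Fin 1) hτ₁
    ((hζ₁.isIntegral M.factorial_pos).tower_top (A := ℚ)).isAlgebraic
  have hp₂ := algebraicIndependent_single_adjoin_of_isAlgebraic (ι := Fin 1) hτ₂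
    ((hζ₂.isIntegral M.factorial_pos).tower_top (A := ℚ)).isAlgebraic
  rw [lvGens_single, lvGens_single, aeval_sumElim_eq_zero_iff hp₁, aeval_sumElim_eq_zero_iff hp₂]
  exact forall_congr' fun m =>
    aeval_const_iff_of_isPrimitiveRoot M.factorial_pos hζ₁ hζ₂ _

/-- **`(τ₁) ↦ (τ₂)` is a cross Γ-isomorphism over the trivial bases** for exponential fields with
standard kernels `τ₁ℤ`, `τ₂ℤ`. [cite: BaysKirby2018ANT, Thm 9.1 (proof)] -/
theorem isGammaIsoTw₂_bot_single_of_expKernel {τ₁ : F₁} {τ₂ : F₂}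
    (hker₁ : expKernel F₁ = AddSubgroup.zmultiples τ₁) (hτ₁ : Transcendental ℚ τ₁)
    (hker₂ : expKernel F₂ = AddSubgroup.zmultiples τ₂) (hτ₂ : Transcendental ℚ τ₂) :
    IsGammaIsoTw₂ (botBaseEquiv F₁ F₂) ![τ₁] ![τ₂] :=
  isGammaIsoTw₂_bot_iff.2 fun M P => aeval_lvGens_single_iff_of_expKernel hker₁ hτ₁ hker₂ hτ₂ M P

end TauKernel

/-! ### The isomorphism `σ₀ : ℚ^{ab}(τ₁) ≃ ℚ^{ab}(τ₂)` of base Γ-fields -/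

section StdKernel

variable {F₁ : Type u} [Field F₁] [CharZero F₁] [Literature.ModelTheory.ExponentialFields.ExponentialRing F₁]
variable {F₂ : Type u} [Field F₂] [CharZero F₂] [Literature.ModelTheory.ExponentialFields.ExponentialRing F₂]

omit [Literature.ModelTheory.ExponentialFields.ExponentialRing F₁] in
/-- `⊥ + ℚ·(τ) = ℚτ`. [folklore] -/
theorem bot_sup_span_range_single (τ : F₁) :
    (⊥ : Submodule ℚ F₁) ⊔ Submodule.span ℚ (range ![τ]) = Submodule.span ℚ {τ} := by
  rw [bot_sup_eq, range_single]

/-- Membership bridge: `x ∈ (⊥)⁰(allGens (τ)) ↔ x ∈ fieldOf (ℚτ)`. [folklore] -/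
theorem mem_adjoin_allGens_single_iff (τ : F₁) {x : F₁} :
    x ∈ IntermediateField.adjoin (fieldOf (⊥ : Submodule ℚ F₁)) (allGens ![τ]) ↔
      x ∈ fieldOf (Submodule.span ℚ ({τ} : Set F₁)) := by
  rw [mem_adjoinField_allGens_iff, bot_sup_span_range_single]

variable {τ₁ : F₁} {τ₂ : F₂}

/-- **The isomorphism of base Γ-fields `σ₀ : ℚ^{ab}(τ₁) ≃+* ℚ^{ab}(τ₂)`** attached to a cross
Γ-isomorphism `(τ₁) ↦ (τ₂)` over the trivial bases (e.g. from standard kernels,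
`isGammaIsoTw₂_bot_single_of_expKernel`): the field isomorphism
`IsGammaIsoTw₂.fieldEquiv : (⊥)⁰(allGens (τ₁)) ≃ (⊥)⁰(allGens (τ₂))` read on
`fieldOf (ℚτ₁) ≃ fieldOf (ℚτ₂)`. [cite: BaysKirby2018ANT, §9.1 (`F_base = ℚ^{ab}(τ)`)] -/
def stdKernelBaseEquiv (h : IsGammaIsoTw₂ (botBaseEquiv F₁ F₂) ![τ₁] ![τ₂]) :
    fieldOf (Submodule.span ℚ ({τ₁} : Set F₁)) ≃+* fieldOf (Submodule.span ℚ ({τ₂} : Set F₂)) where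
  toFun x := ⟨h.fieldEquiv ⟨x, (mem_adjoin_allGens_single_iff τ₁).2 x.2⟩,
    (mem_adjoin_allGens_single_iff τ₂).1 (h.fieldEquiv _).2⟩
  invFun y := ⟨h.fieldEquiv.symm ⟨y, (mem_adjoin_allGens_single_iff τ₂).2 y.2⟩,
    (mem_adjoin_allGens_single_iff τ₁).1 (h.fieldEquiv.symm _).2⟩
  left_inv x := by
    apply Subtype.ext
    change ((h.fieldEquiv.symm ⟨(h.fieldEquiv ⟨x, _⟩ : F₂), _⟩ : _) : F₁) = x
    have : (⟨(h.fieldEquiv ⟨x, (mem_adjoin_allGens_single_iff τ₁).2 x.2⟩ : F₂),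
        (mem_adjoin_allGens_single_iff τ₂).2 ((mem_adjoin_allGens_single_iff τ₂).1
          (h.fieldEquiv ⟨x, (mem_adjoin_allGens_single_iff τ₁).2 x.2⟩).2)⟩ :
        IntermediateField.adjoin (fieldOf (⊥ : Submodule ℚ F₂)) (allGens ![τ₂])) =
        h.fieldEquiv ⟨x, (mem_adjoin_allGens_single_iff τ₁).2 x.2⟩ := Subtype.ext rfl
    rw [this, RingEquiv.symm_apply_apply]
  right_inv y := by
    apply Subtype.ext
    change ((h.fieldEquiv ⟨(h.fieldEquiv.symm ⟨y, _⟩ : F₁), _⟩ : _) : F₂) = y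
    have : (⟨(h.fieldEquiv.symm ⟨y, (mem_adjoin_allGens_single_iff τ₂).2 y.2⟩ : F₁),
        (mem_adjoin_allGens_single_iff τ₁).2 ((mem_adjoin_allGens_single_iff τ₁).1
          (h.fieldEquiv.symm ⟨y, (mem_adjoin_allGens_single_iff τ₂).2 y.2⟩).2)⟩ :
        IntermediateField.adjoin (fieldOf (⊥ : Submodule ℚ F₁)) (allGens ![τ₁])) =
        h.fieldEquiv.symm ⟨y, (mem_adjoin_allGens_single_iff τ₂).2 y.2⟩ := Subtype.ext rfl
    rw [this, RingEquiv.apply_symm_apply]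
  map_mul' x y := by
    apply Subtype.ext
    change ((h.fieldEquiv ⟨x * y, _⟩ : _) : F₂) = (h.fieldEquiv ⟨x, _⟩ : F₂) * (h.fieldEquiv ⟨y, _⟩ : F₂)
    have : (⟨(x : F₁) * y, (mem_adjoin_allGens_single_iff τ₁).2 (x * y).2⟩ :
        IntermediateField.adjoin (fieldOf (⊥ : Submodule ℚ F₁)) (allGens ![τ₁])) =
        ⟨x, (mem_adjoin_allGens_single_iff τ₁).2 x.2⟩ * ⟨y, (mem_adjoin_allGens_single_iff τ₁).2 y.2⟩ :=
      Subtype.ext rfl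
    rw [this, map_mul]
    rfl
  map_add' x y := by
    apply Subtype.ext
    change ((h.fieldEquiv ⟨x + y, _⟩ : _) : F₂) = (h.fieldEquiv ⟨x, _⟩ : F₂) + (h.fieldEquiv ⟨y, _⟩ : F₂)
    have : (⟨(x : F₁) + y, (mem_adjoin_allGens_single_iff τ₁).2 (x + y).2⟩ :
        IntermediateField.adjoin (fieldOf (⊥ : Submodule ℚ F₁)) (allGens ![τ₁])) =
        ⟨x, (mem_adjoin_allGens_single_iff τ₁).2 x.2⟩ + ⟨y, (mem_adjoin_allGens_single_iff τ₁).2 y.2⟩ :=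
      Subtype.ext rfl
    rw [this, map_add]
    rfl

/-- `σ₀` is `θ` on underlying elements. [folklore] -/
theorem coe_stdKernelBaseEquiv (h : IsGammaIsoTw₂ (botBaseEquiv F₁ F₂) ![τ₁] ![τ₂])
    (x : fieldOf (Submodule.span ℚ ({τ₁} : Set F₁))) :
    (stdKernelBaseEquiv h x : F₂) =
      (h.fieldEquiv ⟨x, (mem_adjoin_allGens_single_iff τ₁).2 x.2⟩ : F₂) := rfl

/-- `σ₀⁻¹` is `θ⁻¹` on underlying elements. [folklore] -/
theorem coe_stdKernelBaseEquiv_symm (h : IsGammaIsoTw₂ (botBaseEquiv F₁ F₂) ![τ₁] ![τ₂])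
    (y : fieldOf (Submodule.span ℚ ({τ₂} : Set F₂))) :
    ((stdKernelBaseEquiv h).symm y : F₁) =
      (h.fieldEquiv.symm ⟨y, (mem_adjoin_allGens_single_iff τ₂).2 y.2⟩ : F₁) := rfl

/-- **`σ₀ τ₁ = τ₂`.** [folklore] -/
theorem coe_stdKernelBaseEquiv_tau (h : IsGammaIsoTw₂ (botBaseEquiv F₁ F₂) ![τ₁] ![τ₂])
    (hτ : τ₁ ∈ fieldOf (Submodule.span ℚ ({τ₁} : Set F₁))) :
    (stdKernelBaseEquiv h ⟨τ₁, hτ⟩ : F₂) = τ₂ := by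
  rw [coe_stdKernelBaseEquiv]
  have := h.coe_fieldEquiv_apply 0 ((mem_adjoin_allGens_single_iff τ₁).2 hτ)
  simpa using this

/-- **`σ₀` is an isomorphism of base Γ-fields `ℚ^{ab}(τ₁) ≅ ℚ^{ab}(τ₂)`**: it maps `ℚτ₁` onto
`ℚτ₂` and commutes with `exp` there (`σ₀ (exp (q τ₁)) = exp (q τ₂)`).
[cite: BaysKirby2018ANT, §9.1 and Thm 9.1 (proof)] -/
theorem isEBaseIso₂_stdKernelBaseEquiv (h : IsGammaIsoTw₂ (botBaseEquiv F₁ F₂) ![τ₁] ![τ₂]) :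
    IsEBaseIso₂ (Submodule.span ℚ ({τ₁} : Set F₁)) (Submodule.span ℚ ({τ₂} : Set F₂))
      (stdKernelBaseEquiv h) := by
  have hσ : IsEBaseIso₂ (⊥ : Submodule ℚ F₁) (⊥ : Submodule ℚ F₂) (botBaseEquiv F₁ F₂) := isEBaseIso₂_bot
  have hσ' : IsEBaseIso₂ (⊥ : Submodule ℚ F₂) (⊥ : Submodule ℚ F₁) (botBaseEquiv F₂ F₁) := isEBaseIso₂_bot
  have hs : IsGammaIsoTw₂ (botBaseEquiv F₂ F₁) ![τ₂] ![τ₁] := by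
    rw [← botBaseEquiv_symm]; exact h.symm
  refine ⟨fun {x} hx => ?_, fun {y} hy => ?_, fun {x} hx => ?_⟩
  · rw [coe_stdKernelBaseEquiv]
    have hx' : x ∈ (⊥ : Submodule ℚ F₁) ⊔ Submodule.span ℚ (range ![τ₁]) := by
      rwa [bot_sup_span_range_single]
    have := h.coe_fieldEquiv_mem_sup hσ hx' ((mem_adjoin_allGens_single_iff τ₁).2 (mem_fieldOf_of_mem hx))
    rwa [bot_sup_span_range_single] at this
  · rw [coe_stdKernelBaseEquiv_symm, h.coe_fieldEquiv_symm_eq]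
    have hy' : y ∈ (⊥ : Submodule ℚ F₂) ⊔ Submodule.span ℚ (range ![τ₂]) := by
      rwa [bot_sup_span_range_single]
    have hs' : IsGammaIsoTw₂ (botBaseEquiv F₁ F₂).symm ![τ₂] ![τ₁] := h.symm
    have := hs'.coe_fieldEquiv_mem_sup (by rw [botBaseEquiv_symm]; exact hσ') hy'
      ((mem_adjoin_allGens_single_iff τ₂).2 (mem_fieldOf_of_mem hy))
    rwa [bot_sup_span_range_single] at this
  · rw [coe_stdKernelBaseEquiv, coe_stdKernelBaseEquiv]
    have hx' : x ∈ (⊥ : Submodule ℚ F₁) ⊔ Submodule.span ℚ (range ![τ₁]) := by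
      rwa [bot_sup_span_range_single]
    exact h.coe_fieldEquiv_exp_apply hσ hx' _ _

/-- **Existence form**: for exponential fields `F₁`, `F₂` with standard kernels `τ₁ℤ`, `τ₂ℤ`
(`τᵢ` transcendental) there is an isomorphism of base Γ-fields `σ₀ : ℚ^{ab}(τ₁) ≅ ℚ^{ab}(τ₂)`
with `σ₀ τ₁ = τ₂` over which `(τ₁) ↦ (τ₂)` is a cross Γ-isomorphism of the trivial kind
(`IsGammaIsoTw₂ σ₀ elim0 elim0` being vacuous, we record the `1`-tuples over `⊥`).
[cite: BaysKirby2018ANT, Thm 9.1 (proof)] -/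
theorem exists_isEBaseIso₂_of_expKernel
    (hker₁ : expKernel F₁ = AddSubgroup.zmultiples τ₁) (hτ₁ : Transcendental ℚ τ₁)
    (hker₂ : expKernel F₂ = AddSubgroup.zmultiples τ₂) (hτ₂ : Transcendental ℚ τ₂) :
    ∃ σ₀ : fieldOf (Submodule.span ℚ ({τ₁} : Set F₁)) ≃+* fieldOf (Submodule.span ℚ ({τ₂} : Set F₂)),
      IsEBaseIso₂ (Submodule.span ℚ ({τ₁} : Set F₁)) (Submodule.span ℚ ({τ₂} : Set F₂)) σ₀ ∧
      (σ₀ ⟨τ₁, mem_fieldOf_of_mem (Submodule.subset_span rfl)⟩ : F₂) = τ₂ :=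
  ⟨stdKernelBaseEquiv (isGammaIsoTw₂_bot_single_of_expKernel hker₁ hτ₁ hker₂ hτ₂),
    isEBaseIso₂_stdKernelBaseEquiv _, coe_stdKernelBaseEquiv_tau _ _⟩

end StdKernel

end GammaField

end Literature.NumberTheory.Transcendental
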